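import Literature.AnabelianGeometry.AbsoluteAnabelian.AbsTopIII.KummerFaithfulPadicConsequences
import Literature.AnabelianGeometry.AbsoluteAnabelian.AbsTopIII.CurveModelSchemaWitnesses
import HarnessLib

/-!
# [AbsTopIII] Prop. 1.8 (i), (ii) for Kummer classes of units, relative to a model:
# INSTANCE FORMS of `IntrinsicKummerModel.Prop_1_8_i_units` (FACT-LIST F-0376) and
# `IntrinsicKummerModel.Prop_1_8_ii_units` (F-0377) at LABELLED TOY CARRIERS with every binder inhabited

S. Mochizuki, *Topics in Absolute Anabelian Geometry III: Global Reconstruction Algorithms*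
[MochizukiAbsTopIII2015], §1, Prop. 1.8 p. 36 (manuscript pagination, lit key `paper:url-5493eb38cbb7`):
"(i) A class `η ∈ P_U` is the Kummer class of a nonconstant NF-rational function if and only if there
exist a positive multiple `η†` of `η` and NF-points `x₁, x₂ ∈ U(k_x)` [...] such that `η†|_{x₁} = 0`,
`η†|_{x₂} ≠ 0`"; "(ii) Suppose that there exist nonconstant NF-rational functions `∈ Γ(U, 𝒪_U^×)`.
Then a class `η ∈ P_U ⋂ H¹(G_k, M_X)` is the Kummer class of an NF-constant `∈ k^×` if and only if there
exist a nonconstant NF-rational function `f ∈ Γ(U, 𝒪_U^×)` and an NF-point `x` [...] such that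
`κ_U(f)|_x = η|_{G_{k_x}}`" (printed proof p. 36 l. 42–50: "follow immediately from the definitions" and
the value-surjectivity `X_NF(k̄_NF) ↠ ℙ¹(k̄_NF)`).

PROOF-ONLY companion (cell abc-iut, block F, seat abc-iut-f-072 gen 13, KEY row «INST59G2»; no `def`,
no `instance`, no notation, no new named fact) of abc-iut-L4-t1's `KummerIntrinsic.lean` (imported via
`KummerFaithfulPadicConsequences`, never edited).

CONTEXT.  Both rows are NAMED FACTS RELATIVE TO A MODEL `M : IntrinsicKummerModel` (typed for Kummer
classes of UNITS `η = κ_U(f)`, resp. of constants `η = κ_U(c)`).  Their universal closures are REFUTED in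
the tree (`not_forall_prop_1_8_i_units`, `not_forall_prop_1_8_ii_units`, abc-iut-f-078 / f-084 / f-085:
at abc-iut-f-084's junk model over a Kummer-faithful field the indeterminate `X ∈ k(X)` is a nonconstant
NF-rational unit with trivial Kummer class), and the only instance forms of record were DEGENERATE in the
curve binder (`prop_1_8_i_units_of_isEmpty_curve`, `prop_1_8_ii_units_of_isEmpty_curve`: no curves;
demoted by the F-lit census).  This file supplies, for each row, a `∃`-WITNESS whose head conjunct IS
the row's declaration and whose remaining conjuncts DISPLAY that every hypothesis binder of the row fires
at the witness.

THE TOY CARRIERS (HONEST LABEL «INSTANCE at toy carrier»; not models of any curve).  Over a field `k` of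
characteristic zero (instantiated at the Kummer-faithful `ℚ`, `isKummerFaithful_rat`, and `ℚ_p`,
`isKummerFaithful_padic`) and an ARBITRARY extension `E = (Π ↠ G)` with `G ≅ G_k` and a section
`s : G → Π` (instantiated at `Π = G_k`, identity augmentation, `Δ = 1`, `s = id`; and at abc-iut-f-076's
`CurveModelSchemaWitness.toyExt k H`, `Π = G_k × H ↠ G_k` for ANY profinite `H`, `Δ = {1} × H`
NON-trivial, `s = inl`): ONE curve `U = X` with `Π_U := Π`, `res := 𝟙`, ONE `k`-rational closed point
with section `s` and `D_x = s(G)`, flagged NF, `ord ≡ 0` (every unit is regular), NF-flags `True`, the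
TRIVIAL Kummer map `κ_U ≡ 0`; and

* carrier **A** for Prop. 1.8 (i) (units): NO cusps and `K_U := k` — the proper-curve reading
  "`Γ(X, 𝒪_X^×) = k^×`: no nonconstant regular unit".  At A the row holds because BOTH sides of its `↔`
  FAIL for every regular unit `f`: `f` is constant, and no multiple of `κ_U(f)|_{x₂} = 0` is `≠ 0`;
* carrier **B** for Prop. 1.8 (ii) (constants): ONE cusp with `D = Π_U` (rational) and
  `K_U := k(X) = RatFunc k` with the NF-constant flag `True` — so the row's extra hypothesis "there exist
  nonconstant NF-rational functions `∈ Γ(U, 𝒪_U^×)`" FIRES (the indeterminate `X`).  At B the row holds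
  because BOTH sides of its `↔` HOLD for every constant unit `c`: `c` is flagged an NF-constant, and
  `κ_U(X)|_x = 0 = κ_U(c)|_x` at the NF-point `x`.

(Why two carriers: at B, Prop. 1.8 (i) FAILS — that is abc-iut-f-084's refutation; at A, the extra
hypothesis of Prop. 1.8 (ii) cannot fire.  A carrier at which (i) holds with a TRUE left-hand side needs a
unit whose Kummer class has non-torsion restriction to a decomposition group, i.e. a non-trivial
cyclotome `M_X = Hom(H²(Δ_X, Ẑ), Ẑ)` — a surface-group `H²` computation outside the tree.)

WHAT THIS IS NOT: not the printed theorem; the carriers have `κ_U ≡ 0` and no anabelian or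
Kummer-theoretic content (both rows hold at them for EVERY extension `E`, which is exactly why).  Refereed pre-IUT material typed statements-first (D-0014); typed ≠ proved; an
instance-form theorem about OUR typed statement ≠ a theorem about [AbsTopIII] in print; nothing here bears
on [IUTchIII] Cor. 3.12 or takes a side; axioms standard.
-/

noncomputable section

open CategoryTheory

universe u

namespace Literature.AnabelianGeometry.AbsoluteAnabelian.AbsTopIII

namespace IntrinsicKummerModel

/-! ### Carrier A: `K_U = k`, no cusps — Prop. 1.8 (i) for units (F-0376) -/

/-- **MASTER WITNESS A (toy carrier over a Kummer-faithful `k` and an ARBITRARY extension `E` with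
`G ≅ G_k` and a section `s`; HONEST LABEL: toy carrier).**  ONE curve `U = X` over `k` with `Π_U := Π_E`,
`res := 𝟙`, no cusps, one `k`-rational NF-point with section `s` and `D_x = s(G)`, `K_U := k`,
`ord ≡ 0`, NF-flags `True`, `κ_U ≡ 0` — at which `Prop_1_8_i_units` (F-0376) HOLDS (both sides of its
`↔` fail for every regular unit), with the row's hypothesis telescope displayed INHABITED: the curve
(whose extension IS `E`), cofinite open, proper, scheme-like, genus `≥ 2`, Kummer-faithful base, cusps
all rational, NF-curve, an inhabited type of points all NF, an inhabited type of regular units all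
NF-rational. [cite: MochizukiAbsTopIII2015, Prop 1.8 (i) p.36] -/
theorem exists_toyCarrierA_prop_1_8_i_units (k : Type u) [Field k] [CharZero k]
    (hk : IsKummerFaithful k) (E : FundamentalExtension.{u}) (eG : E.gal ≅ absoluteGaloisGrp k)
    (s : E.Section) :
    ∃ M : IntrinsicKummerModel.{u},
      M.Prop_1_8_i_units ∧
        ∃ (U : M.Curve) (_ : M.IsCofiniteOpen U U),
          M.IsProper U ∧ M.ext U = E ∧ M.IsScheme U ∧ 2 ≤ M.genus U ∧ IsKummerFaithful (M.base U) ∧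
            (∀ c : (M.cusps U).Cusp, (M.cusps U).IsRational c) ∧ M.IsNFCurve U ∧
            Nonempty (M.Point U) ∧ (∀ y : M.Point U, M.IsNFPoint U y) ∧
            Nonempty (M.regularUnits U) ∧
            ∀ f : M.regularUnits U, M.IsNFRational U ((f : (M.FunctionField U)ˣ) : M.FunctionField U) := by
  -- no cusps (`U = X` proper)
  let C : E.CuspidalData :=
    { Cusp := PEmpty.{u + 1}, Dcusp := fun x => x.elim, Icusp := fun x => x.elim
      Icusp_eq := fun x => x.elim, isClosed_Dcusp := fun x => x.elim, eq_of_conj := fun x => x.elim }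
  let M : IntrinsicKummerModel.{u} :=
    { Curve := PUnit.{u + 2}
      base := fun _ => k
      instField := fun _ => inferInstanceAs (Field k)
      instCharZero := fun _ => inferInstanceAs (CharZero k)
      ext := fun _ => E
      galIso := fun _ => eG
      cusps := fun _ => C
      IsProper := fun _ => True
      IsScheme := fun _ => True
      genus := fun _ => 2
      FunctionField := fun _ => k
      instFunctionField := fun _ => inferInstanceAs (Field k)
      instAlgebra := fun _ => Algebra.id k
      Point := fun _ => PUnit.{u + 1}
      decomp := fun _ _ => s.decompositionGroup
      IsNFCurve := fun _ => True
      IsNFPoint := fun _ _ => True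
      IsNFRational := fun _ _ => True
      IsNFConstant := fun _ _ => True
      NFFunctionField := fun _ => k
      instNFFunctionField := fun _ => inferInstanceAs (Field k)
      IsStrictlyBelyiType := fun _ => True
      IsCofiniteOpen := fun _ _ => True
      res := fun _ => 𝟙 E
      IsRationalPt := fun _ _ => True
      ptSection := fun _ _ => s
      ptSection_range := fun _ _ => rfl
      ord := fun _ => 1
      kummerMap := fun _ _ => 1 }
  -- every Kummer restriction vanishes (`κ_U ≡ 0`)
  have hres : ∀ (h : M.IsCofiniteOpen PUnit.unit PUnit.unit) (hX : M.IsProper PUnit.unit)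
      (D : Subgroup (M.ext PUnit.unit).arith) (f : M.regularUnits PUnit.unit),
      M.kummerRes h hX D f = 0 := by
    intro h hX D f
    change (cyclotomeModH1Res (M.res (U := PUnit.unit) (U' := PUnit.unit) h) ZHatCoeff.{u} D) 0 = 0
    exact map_zero _
  refine ⟨M, ?_, PUnit.unit, trivial, trivial, rfl, trivial, le_rfl, hk, fun c => c.elim, trivial,
    ⟨PUnit.unit⟩, fun _ => trivial, ⟨1⟩, fun _ => trivial⟩
  -- Prop. 1.8 (i) for units: both sides fail for every regular unit
  rintro ⟨⟩ ⟨⟩ h hX - - - - - - f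
  constructor
  · rintro ⟨-, hnc⟩
    exact (hnc ⟨((f : (M.FunctionField PUnit.unit)ˣ) : M.FunctionField PUnit.unit), rfl⟩).elim
  · rintro ⟨n, -, x₁, x₂, -, -, -, hne⟩
    exact (hne (by rw [hres, smul_zero])).elim

/-- **F-0376 `IntrinsicKummerModel.Prop_1_8_i_units` — INSTANCE FORM at toy carrier A over `ℚ` with
`Π_U = G_ℚ`** (`Δ = 1`, displayed as bijectivity of the augmentation; `isKummerFaithful_rat`),
hypothesis telescope displayed INHABITED.  HONEST LABEL: toy carrier (`K_U = k`, `κ_U ≡ 0`); both sides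
of the row's `↔` fail for every regular unit. [cite: MochizukiAbsTopIII2015, Prop 1.8 (i) p.36] -/
theorem prop_1_8_i_units_toyCarrier_rat :
    ∃ M : IntrinsicKummerModel.{0},
      M.Prop_1_8_i_units ∧
        ∃ (U : M.Curve) (_ : M.IsCofiniteOpen U U),
          M.IsProper U ∧ Function.Bijective (M.ext U).aug ∧ M.IsScheme U ∧ 2 ≤ M.genus U ∧
            IsKummerFaithful (M.base U) ∧
            (∀ c : (M.cusps U).Cusp, (M.cusps U).IsRational c) ∧ M.IsNFCurve U ∧
            Nonempty (M.Point U) ∧ (∀ y : M.Point U, M.IsNFPoint U y) ∧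
            Nonempty (M.regularUnits U) ∧
            ∀ f : M.regularUnits U, M.IsNFRational U ((f : (M.FunctionField U)ˣ) : M.FunctionField U) := by
  let E : FundamentalExtension.{0} :=
    { arith := absoluteGaloisGrp ℚ, gal := absoluteGaloisGrp ℚ
      aug := ContinuousMonoidHom.id _, aug_surjective := Function.surjective_id }
  obtain ⟨M, h18, U, h, hX, hE, hrest⟩ := exists_toyCarrierA_prop_1_8_i_units ℚ isKummerFaithful_rat E
    (Iso.refl _) ⟨ContinuousMonoidHom.id _, fun _ => rfl⟩
  exact ⟨M, h18, U, h, hX, by rw [hE]; exact Function.bijective_id, hrest⟩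

/-- **F-0376 — INSTANCE FORM at toy carrier A over `ℚ_p` with `Π_U = G_{ℚ_p}`** (`Δ = 1`;
`isKummerFaithful_padic`), same display.  HONEST LABEL: toy carrier.
[cite: MochizukiAbsTopIII2015, Prop 1.8 (i) p.36] -/
theorem prop_1_8_i_units_toyCarrier_padic (p : ℕ) [Fact p.Prime] :
    ∃ M : IntrinsicKummerModel.{0},
      M.Prop_1_8_i_units ∧
        ∃ (U : M.Curve) (_ : M.IsCofiniteOpen U U),
          M.IsProper U ∧ Function.Bijective (M.ext U).aug ∧ M.IsScheme U ∧ 2 ≤ M.genus U ∧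
            IsKummerFaithful (M.base U) ∧
            (∀ c : (M.cusps U).Cusp, (M.cusps U).IsRational c) ∧ M.IsNFCurve U ∧
            Nonempty (M.Point U) ∧ (∀ y : M.Point U, M.IsNFPoint U y) ∧
            Nonempty (M.regularUnits U) ∧
            ∀ f : M.regularUnits U, M.IsNFRational U ((f : (M.FunctionField U)ˣ) : M.FunctionField U) := by
  let E : FundamentalExtension.{0} :=
    { arith := absoluteGaloisGrp ℚ_[p], gal := absoluteGaloisGrp ℚ_[p]
      aug := ContinuousMonoidHom.id _, aug_surjective := Function.surjective_id }
  obtain ⟨M, h18, U, h, hX, hE, hrest⟩ := exists_toyCarrierA_prop_1_8_i_units ℚ_[p]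
    (isKummerFaithful_padic p) E (Iso.refl _) ⟨ContinuousMonoidHom.id _, fun _ => rfl⟩
  exact ⟨M, h18, U, h, hX, by rw [hE]; exact Function.bijective_id, hrest⟩

/-- **F-0376 — INSTANCE FORM at toy carrier A over `ℚ_p` with `Π_U = G_{ℚ_p} × H ↠ G_{ℚ_p}` for ANY
profinite group `H`** (abc-iut-f-076's `CurveModelSchemaWitness.toyExt ℚ_p H`; `Δ_U = {1} × H`
NON-trivial for `H ≠ 1`; the NF-point is rational with section `inl`, `D_x = G_{ℚ_p} × {1}`), same display
plus the identification of the curve's extension.  HONEST LABEL: toy carrier (`K_U = k`, `κ_U ≡ 0`).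
[cite: MochizukiAbsTopIII2015, Prop 1.8 (i) p.36] -/
theorem prop_1_8_i_units_toyCarrier_prod (p : ℕ) [Fact p.Prime] (H : ProfiniteGrp.{0}) :
    ∃ M : IntrinsicKummerModel.{0},
      M.Prop_1_8_i_units ∧
        ∃ (U : M.Curve) (_ : M.IsCofiniteOpen U U),
          M.IsProper U ∧ M.ext U = CurveModelSchemaWitness.toyExt ℚ_[p] H ∧ M.IsScheme U ∧
            2 ≤ M.genus U ∧ IsKummerFaithful (M.base U) ∧
            (∀ c : (M.cusps U).Cusp, (M.cusps U).IsRational c) ∧ M.IsNFCurve U ∧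
            Nonempty (M.Point U) ∧ (∀ y : M.Point U, M.IsNFPoint U y) ∧
            Nonempty (M.regularUnits U) ∧
            ∀ f : M.regularUnits U, M.IsNFRational U ((f : (M.FunctionField U)ˣ) : M.FunctionField U) :=
  exists_toyCarrierA_prop_1_8_i_units ℚ_[p] (isKummerFaithful_padic p)
    (CurveModelSchemaWitness.toyExt ℚ_[p] H) (Iso.refl _) ⟨ContinuousMonoidHom.inl _ _, fun _ => rfl⟩

/-! ### Carrier B: `K_U = k(X)`, one rational cusp — Prop. 1.8 (ii) for constants (F-0377) -/

/-- **MASTER WITNESS B (toy carrier over a Kummer-faithful `k` and an ARBITRARY extension `E` with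
`G ≅ G_k` and a section `s`; HONEST LABEL: toy carrier).**  ONE curve `U = X` over `k` with `Π_U := Π_E`,
`res := 𝟙`, one cusp with `D = Π` (rational, `I = Π ⊓ Δ`), one `k`-rational NF-point with section `s` and
`D_x = s(G)`, `K_U := k(X)`, `ord ≡ 0`, NF-flags `True`, `κ_U ≡ 0` — at which `Prop_1_8_ii_units`
(F-0377) HOLDS (both sides of its `↔` hold for every constant unit), with the row's hypothesis telescope
displayed INHABITED: the curve (whose extension IS `E`), cofinite open, proper, scheme-like, genus `≥ 2`,
Kummer-faithful base, an inhabited type of cusps all rational, NF-curve, a NONCONSTANT NF-rational regular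
unit (the indeterminate `X`), an NF-point, and a constant regular unit.
[cite: MochizukiAbsTopIII2015, Prop 1.8 (ii) p.36] -/
theorem exists_toyCarrierB_prop_1_8_ii_units (k : Type u) [Field k] [CharZero k]
    (hk : IsKummerFaithful k) (E : FundamentalExtension.{u}) (eG : E.gal ≅ absoluteGaloisGrp k)
    (s : E.Section) :
    ∃ M : IntrinsicKummerModel.{u},
      M.Prop_1_8_ii_units ∧
        ∃ (U : M.Curve) (_ : M.IsCofiniteOpen U U),
          M.IsProper U ∧ M.ext U = E ∧ M.IsScheme U ∧ 2 ≤ M.genus U ∧ IsKummerFaithful (M.base U) ∧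
            Nonempty (M.cusps U).Cusp ∧ (∀ c : (M.cusps U).Cusp, (M.cusps U).IsRational c) ∧
            M.IsNFCurve U ∧
            (∃ g : M.regularUnits U,
              M.IsNFRational U ((g : (M.FunctionField U)ˣ) : M.FunctionField U) ∧
                ((g : (M.FunctionField U)ˣ) : M.FunctionField U) ∉
                  Set.range (algebraMap (M.base U) (M.FunctionField U))) ∧
            (∃ y : M.Point U, M.IsNFPoint U y) ∧
            ∃ c : (M.base U)ˣ,
              Units.map (algebraMap (M.base U) (M.FunctionField U) : _ →* _) c ∈ M.regularUnits U := by
  -- one cusp with decomposition group `Π`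
  let C : E.CuspidalData :=
    { Cusp := PUnit.{u + 1}, Dcusp := fun _ => ⊤, Icusp := fun _ => ⊤ ⊓ E.geom
      Icusp_eq := fun _ => rfl
      isClosed_Dcusp := fun _ => by
        rw [Subgroup.coe_top]
        exact isClosed_univ
      eq_of_conj := fun _ _ _ _ => rfl }
  let M : IntrinsicKummerModel.{u} :=
    { Curve := PUnit.{u + 2}
      base := fun _ => k
      instField := fun _ => inferInstanceAs (Field k)
      instCharZero := fun _ => inferInstanceAs (CharZero k)
      ext := fun _ => E
      galIso := fun _ => eG
      cusps := fun _ => C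
      IsProper := fun _ => True
      IsScheme := fun _ => True
      genus := fun _ => 2
      FunctionField := fun _ => RatFunc k
      instFunctionField := fun _ => inferInstanceAs (Field (RatFunc k))
      instAlgebra := fun _ => inferInstanceAs (Algebra k (RatFunc k))
      Point := fun _ => PUnit.{u + 1}
      decomp := fun _ _ => s.decompositionGroup
      IsNFCurve := fun _ => True
      IsNFPoint := fun _ _ => True
      IsNFRational := fun _ _ => True
      IsNFConstant := fun _ _ => True
      NFFunctionField := fun _ => RatFunc k
      instNFFunctionField := fun _ => inferInstanceAs (Field (RatFunc k))
      IsStrictlyBelyiType := fun _ => True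
      IsCofiniteOpen := fun _ _ => True
      res := fun _ => 𝟙 E
      IsRationalPt := fun _ _ => True
      ptSection := fun _ _ => s
      ptSection_range := fun _ _ => rfl
      ord := fun _ => 1
      kummerMap := fun _ _ => 1 }
  -- the nonconstant regular unit `X ∈ Γ(U, 𝒪_U^×) = k(X)^×`
  let Xu : M.regularUnits PUnit.unit :=
    ⟨Units.mk0 RatFunc.X RatFunc.X_ne_zero, (M.mem_regularUnits _).2 fun _ => rfl⟩
  have hXnc : ((Xu : (M.FunctionField PUnit.unit)ˣ) : M.FunctionField PUnit.unit) ∉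
      Set.range (algebraMap (M.base PUnit.unit) (M.FunctionField PUnit.unit)) :=
    ratFuncX_not_mem_range_algebraMap k
  have hcusp : ∀ c : (M.cusps PUnit.unit).Cusp, (M.cusps PUnit.unit).IsRational c := by
    intro c g _
    obtain ⟨y, hy⟩ := E.aug_surjective g
    exact ⟨y, Subgroup.mem_top y, hy⟩
  -- every Kummer restriction vanishes (`κ_U ≡ 0`)
  have hres : ∀ (h : M.IsCofiniteOpen PUnit.unit PUnit.unit) (hX : M.IsProper PUnit.unit)
      (D : Subgroup (M.ext PUnit.unit).arith) (f : M.regularUnits PUnit.unit),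
      M.kummerRes h hX D f = 0 := by
    intro h hX D f
    change (cyclotomeModH1Res (M.res (U := PUnit.unit) (U' := PUnit.unit) h) ZHatCoeff.{u} D) 0 = 0
    exact map_zero _
  refine ⟨M, ?_, PUnit.unit, trivial, trivial, rfl, trivial, le_rfl, hk, ⟨PUnit.unit⟩, hcusp, trivial,
    ⟨Xu, trivial, hXnc⟩, ⟨PUnit.unit, trivial⟩, 1, (M.mem_regularUnits _).2 fun _ => rfl⟩
  -- Prop. 1.8 (ii) for constants: both sides hold for every constant unit
  rintro ⟨⟩ ⟨⟩ h hX - - - - - - - c hc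
  constructor
  · intro _
    exact ⟨Xu, PUnit.unit, trivial, hXnc, trivial, by rw [hres, hres]⟩
  · intro _
    trivial

/-- **F-0377 `IntrinsicKummerModel.Prop_1_8_ii_units` — INSTANCE FORM at toy carrier B over `ℚ` with
`Π_U = G_ℚ`** (`Δ = 1`, displayed as bijectivity of the augmentation; `isKummerFaithful_rat`), hypothesis
telescope displayed INHABITED (including the row's extra hypothesis: a NONCONSTANT NF-rational regular
unit).  HONEST LABEL: toy carrier (`K_U = k(X)`, `κ_U ≡ 0`, NF-constant flag `True`); both sides of the
row's `↔` hold for every constant unit. [cite: MochizukiAbsTopIII2015, Prop 1.8 (ii) p.36] -/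
theorem prop_1_8_ii_units_toyCarrier_rat :
    ∃ M : IntrinsicKummerModel.{0},
      M.Prop_1_8_ii_units ∧
        ∃ (U : M.Curve) (_ : M.IsCofiniteOpen U U),
          M.IsProper U ∧ Function.Bijective (M.ext U).aug ∧ M.IsScheme U ∧ 2 ≤ M.genus U ∧
            IsKummerFaithful (M.base U) ∧
            Nonempty (M.cusps U).Cusp ∧ (∀ c : (M.cusps U).Cusp, (M.cusps U).IsRational c) ∧
            M.IsNFCurve U ∧
            (∃ g : M.regularUnits U,
              M.IsNFRational U ((g : (M.FunctionField U)ˣ) : M.FunctionField U) ∧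
                ((g : (M.FunctionField U)ˣ) : M.FunctionField U) ∉
                  Set.range (algebraMap (M.base U) (M.FunctionField U))) ∧
            (∃ y : M.Point U, M.IsNFPoint U y) ∧
            ∃ c : (M.base U)ˣ,
              Units.map (algebraMap (M.base U) (M.FunctionField U) : _ →* _) c ∈ M.regularUnits U := by
  let E : FundamentalExtension.{0} :=
    { arith := absoluteGaloisGrp ℚ, gal := absoluteGaloisGrp ℚ
      aug := ContinuousMonoidHom.id _, aug_surjective := Function.surjective_id }
  obtain ⟨M, h18, U, h, hX, hE, hrest⟩ := exists_toyCarrierB_prop_1_8_ii_units ℚ isKummerFaithful_rat E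
    (Iso.refl _) ⟨ContinuousMonoidHom.id _, fun _ => rfl⟩
  exact ⟨M, h18, U, h, hX, by rw [hE]; exact Function.bijective_id, hrest⟩

/-- **F-0377 — INSTANCE FORM at toy carrier B over `ℚ_p` with `Π_U = G_{ℚ_p}`** (`Δ = 1`;
`isKummerFaithful_padic`), same display.  HONEST LABEL: toy carrier.
[cite: MochizukiAbsTopIII2015, Prop 1.8 (ii) p.36] -/
theorem prop_1_8_ii_units_toyCarrier_padic (p : ℕ) [Fact p.Prime] :
    ∃ M : IntrinsicKummerModel.{0},
      M.Prop_1_8_ii_units ∧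
        ∃ (U : M.Curve) (_ : M.IsCofiniteOpen U U),
          M.IsProper U ∧ Function.Bijective (M.ext U).aug ∧ M.IsScheme U ∧ 2 ≤ M.genus U ∧
            IsKummerFaithful (M.base U) ∧
            Nonempty (M.cusps U).Cusp ∧ (∀ c : (M.cusps U).Cusp, (M.cusps U).IsRational c) ∧
            M.IsNFCurve U ∧
            (∃ g : M.regularUnits U,
              M.IsNFRational U ((g : (M.FunctionField U)ˣ) : M.FunctionField U) ∧
                ((g : (M.FunctionField U)ˣ) : M.FunctionField U) ∉
                  Set.range (algebraMap (M.base U) (M.FunctionField U))) ∧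
            (∃ y : M.Point U, M.IsNFPoint U y) ∧
            ∃ c : (M.base U)ˣ,
              Units.map (algebraMap (M.base U) (M.FunctionField U) : _ →* _) c ∈ M.regularUnits U := by
  let E : FundamentalExtension.{0} :=
    { arith := absoluteGaloisGrp ℚ_[p], gal := absoluteGaloisGrp ℚ_[p]
      aug := ContinuousMonoidHom.id _, aug_surjective := Function.surjective_id }
  obtain ⟨M, h18, U, h, hX, hE, hrest⟩ := exists_toyCarrierB_prop_1_8_ii_units ℚ_[p]
    (isKummerFaithful_padic p) E (Iso.refl _) ⟨ContinuousMonoidHom.id _, fun _ => rfl⟩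
  exact ⟨M, h18, U, h, hX, by rw [hE]; exact Function.bijective_id, hrest⟩

/-- **F-0377 — INSTANCE FORM at toy carrier B over `ℚ_p` with `Π_U = G_{ℚ_p} × H ↠ G_{ℚ_p}` for ANY
profinite group `H`** (abc-iut-f-076's `CurveModelSchemaWitness.toyExt ℚ_p H`; `Δ_U = {1} × H`
NON-trivial for `H ≠ 1`; one cusp with `I = Δ ≅ H`; the NF-point is rational with section `inl`), same
display plus the identification of the curve's extension.  HONEST LABEL: toy carrier (`K_U = k(X)`,
`κ_U ≡ 0`, NF-constant flag `True`). [cite: MochizukiAbsTopIII2015, Prop 1.8 (ii) p.36] -/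
theorem prop_1_8_ii_units_toyCarrier_prod (p : ℕ) [Fact p.Prime] (H : ProfiniteGrp.{0}) :
    ∃ M : IntrinsicKummerModel.{0},
      M.Prop_1_8_ii_units ∧
        ∃ (U : M.Curve) (_ : M.IsCofiniteOpen U U),
          M.IsProper U ∧ M.ext U = CurveModelSchemaWitness.toyExt ℚ_[p] H ∧ M.IsScheme U ∧
            2 ≤ M.genus U ∧ IsKummerFaithful (M.base U) ∧
            Nonempty (M.cusps U).Cusp ∧ (∀ c : (M.cusps U).Cusp, (M.cusps U).IsRational c) ∧
            M.IsNFCurve U ∧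
            (∃ g : M.regularUnits U,
              M.IsNFRational U ((g : (M.FunctionField U)ˣ) : M.FunctionField U) ∧
                ((g : (M.FunctionField U)ˣ) : M.FunctionField U) ∉
                  Set.range (algebraMap (M.base U) (M.FunctionField U))) ∧
            (∃ y : M.Point U, M.IsNFPoint U y) ∧
            ∃ c : (M.base U)ˣ,
              Units.map (algebraMap (M.base U) (M.FunctionField U) : _ →* _) c ∈ M.regularUnits U :=
  exists_toyCarrierB_prop_1_8_ii_units ℚ_[p] (isKummerFaithful_padic p)
    (CurveModelSchemaWitness.toyExt ℚ_[p] H) (Iso.refl _) ⟨ContinuousMonoidHom.inl _ _, fun _ => rfl⟩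

end IntrinsicKummerModel

end Literature.AnabelianGeometry.AbsoluteAnabelian.AbsTopIII
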